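import Literature.AlgebraicGeometry.ModuliOfAbelianVarieties.SiegelFamilyHumbertModularEquivalence
import Literature.AlgebraicGeometry.ModuliOfAbelianVarieties.SiegelFamilyHumbertSquareInvariant
import HarnessLib

/-!
# The split case `F ≅ ℚ × ℚ` of Runge's standard model: square discriminants `Δ = f²`, and for `Δ = 1` the model
# `H(ℚ × ℚ)` is the `Sp₄(ℤ)`-translate of the diagonal `{diag(τ₁, τ₂)}` — the products `E_{τ₁} × E_{τ₂}`

Layer `Literature/AlgebraicGeometry/ModuliOfAbelianVarieties`, namespace
`Literature.AlgebraicGeometry.ModuliOfAbelianVarieties.SiegelModuli`; lane `lit-hodgefound` (Track 2 foundations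
library, Layer A4), seat `lit-hodgefound-skel-4`, row **A4-64**, FILE 6 (rider). Uses FILE 1
(`SiegelFamilyHumbertModularEmbedding`: `quadDisc`, `quadRoot`, `rungeMatrix`, `modularEmbedding`,
`range_modularEmbedding`), FILE 4 (`SiegelFamilyHumbertModularEquivalence`: `blockDiagSp V W hWV = diag(ᵗV, V⁻¹) ∈ Sp₄(ℝ)`,
image of an integral symplectic matrix, acting by `Z ↦ ᵗV Z V` — `coe_blockDiagSp_smul`) and row A4-62
(`SiegelFamilyHumbertSquareInvariant`: `mem_humbertLocusOfInvariant_one_of_apply_eq_zero` — every diagonal `Z` lies on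
`H_1(𝔥₂)`), BY NAME.

## Sources followed, verbatim

* B. Runge, *Endomorphism rings of abelian surfaces and projective models of their moduli spaces*, Tohoku Math. J. **51**
  (1999), §4 p. 290: "Let `F = ℚ[ω]` be a quadratic `ℚ`-algebra with positive discriminant `Δ_F` […] Hence `F` is a real
  quadratic number field or is isomorphic to `ℚ × ℚ`. Let `σ₁, σ₂` be the projections `F ⊗_ℚ ℝ = ℝ ⊕ ℝ → ℝ` […]
  `R = (σᵢ(ωⱼ))` […] `π[R] = ᵗR (τ₁ 0; 0 τ₂) R`" — for a square discriminant `Δ = f²` the `σᵢ(ω) = (l ± f)/2` are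
  integers, `R ∈ M₂(ℤ)` with `det R = −f`, and for `Δ = 1` (`O ≅ ℤ × ℤ`) `R = (1 1; 1 0)` is unimodular, so that
  `π[R](τ) = ᵗR diag(τ₁, τ₂) R` is the `Sp₄(ℤ)`-translate `diag(ᵗR, R⁻¹)·diag(τ₁, τ₂)` of the period matrix of
  `E_{τ₁} × E_{τ₂}`.
* Ch. Birkenhake, H. Wilhelm, *Humbert surfaces and the Kummer plane*, Trans. AMS **355** (2003), §4 Prop. 4.8 (p. 1830)
  (for `δ = 1`: `H_1` is the surface of products `E₁ × E₂` of elliptic curves with the product polarisation).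

## Contents (definitions with bodies and proved theorems; NO named fact, net debt 0)

* §1 (square discriminants) `quadRoot_of_quadDisc_eq_sq` (`σ₁,₂(ω) = (l ± f)/2`), **`exists_int_quadRoot_of_quadDisc_eq_sq`**
  (they are integers `s₀, s₁` with `s₀ + s₁ = l`, `s₀ − s₁ = f`: `R ∈ M₂(ℤ)`), `det_rungeMatrix_of_quadDisc_eq_sq`
  (`det R = −f`).
* §2 (`Δ = 1`) **`diagPoint τ : 𝔥₂`** (`= diag(τ₁, τ₂)`, with `coe_diagPoint`), **`range_diagPoint`** (`= {Z : z₁₂ = 0}`),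
  `diagPoint_mem_humbertLocusOfInvariant_one`; `quadDisc_zero_one` (`Δ(0,1) = 1`), `quadRoot_zero_one'` (`σ(ω) = 1, 0`),
  **`rungeMatrix_zero_one`** (`R = (1 1; 1 0)`), `splitSp = blockDiagSp (1 1; 1 0) (0 1; 1 −1)`,
  **`modularEmbedding_zero_one_eq_smul_diagPoint`** (`π_{(0,1)}(τ) = P_R · diag(τ₁, τ₂)`), and
  **`humbertLocus_humbertNormalForm_zero_one`** (`H_{(0,1,−1,0,0)} = P_R · {Z : z₁₂ = 0}`: Runge's model of
  `H(ℚ × ℚ)` is the `Sp₄(ℤ)`-translate of the locus of products).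

## Scope

For `Δ = f²` with `f > 1`, `R` has determinant `−f` and `A_{π[R](τ)}` is only ISOGENOUS to `E_{τ₁} × E_{τ₂}`; that
isogeny (and Humbert's lemma `H_1(𝔥₂) = Sp₄(ℤ)·{z₁₂ = 0}`, B–W Prop. 4.5 for `Δ = 1`) are not formalised here.

## References

* [Runge1999EndomorphismRingsAbelianSurfaces] B. Runge, Tohoku Math. J. 51 (1999) 283–303, §4 (pp. 290–291).
* [BirkenhakeWilhelm2003] Ch. Birkenhake, H. Wilhelm, Trans. AMS 355 (2003) 1819–1841, §4 Prop. 4.8 (p. 1830).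
* [Lange2023AbelianVarietiesComplex] H. Lange, *Abelian Varieties over the Complex Numbers* (2023), §3.1.1 (the Siegel
  torus `X_Z`), §8.2 (8.5) (the action of `Sp₄(ℤ)`).
-/

noncomputable section

open Matrix Complex Module Function Set
open scoped UpperHalfPlane

namespace Literature.AlgebraicGeometry.ModuliOfAbelianVarieties

namespace SiegelModuli

open Literature.NumberTheory.Automorphic (siegelUpperHalfSpace)
open Literature.NumberTheory.ModularForms.SiegelUpperHalfSpace
open Literature.Geometry.Kaehler Literature.Geometry.Kaehler.ComplexTorus
open Literature.Analysis.Complex Literature.LinearAlgebra.Alternating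
open Sum

/-! ## §1 Square discriminants: `σᵢ(ω) ∈ ℤ`, `R ∈ M₂(ℤ)`, `det R = −f` -/

section Square

variable {k l : ℤ}

/-- **For `Δ = f²`, `f ≥ 0`: `σ₁(ω) = (l + f)/2`, `σ₂(ω) = (l − f)/2`** ("`F` is a real quadratic number field or is
isomorphic to `ℚ × ℚ`" — the latter exactly when `Δ` is a square). [cite: Runge1999EndomorphismRingsAbelianSurfaces, §4 p. 290] -/
theorem quadRoot_of_quadDisc_eq_sq {f : ℤ} (hf : 0 ≤ f) (h : quadDisc k l = f ^ 2) :
    quadRoot k l 0 = ((l : ℝ) + f) / 2 ∧ quadRoot k l 1 = ((l : ℝ) - f) / 2 := by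
  have hs : Real.sqrt (quadDisc k l : ℝ) = f := by
    rw [h]; push_cast; exact Real.sqrt_sq (by exact_mod_cast hf)
  exact ⟨by rw [quadRoot_zero, hs], by rw [quadRoot_one, hs]⟩

/-- **For `Δ = f²` the real embeddings of `ω` are INTEGERS** (`l ≡ f mod 2` since `l² ≡ f² mod 4`): `R = (1 σ₁(ω); 1 σ₂(ω))
∈ M₂(ℤ)`. [cite: Runge1999EndomorphismRingsAbelianSurfaces, §4 p. 290] -/
theorem exists_int_quadRoot_of_quadDisc_eq_sq {f : ℤ} (hf : 0 ≤ f) (h : quadDisc k l = f ^ 2) :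
    ∃ s : Fin 2 → ℤ, (∀ i, quadRoot k l i = s i) ∧ s 0 + s 1 = l ∧ s 0 - s 1 = f := by
  obtain ⟨h0, h1⟩ := quadRoot_of_quadDisc_eq_sq hf h
  simp only [quadDisc] at h
  have hev : Even (l - f) := by
    rcases Int.even_or_odd (l - f) with he | ho
    · exact he
    · exfalso
      have ho' : Odd (l + f) := by
        have : l + f = (l - f) + 2 * f := by ring
        rw [this]; exact ho.add_even (even_two_mul f)
      have hprod : Odd ((l - f) * (l + f)) := ho.mul ho'
      have heven : Even ((l - f) * (l + f)) := ⟨2 * (-k), by linear_combination h⟩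
      exact (Int.not_odd_iff_even.2 heven) hprod
  obtain ⟨u, hu⟩ := hev
  have hu' : (l : ℝ) - f = u + u := by exact_mod_cast hu
  refine ⟨![u + f, u], fun i ↦ ?_, by simp; linear_combination -hu, by simp⟩
  fin_cases i
  · show quadRoot k l 0 = ((![u + f, u] : Fin 2 → ℤ) 0 : ℝ)
    rw [h0]; simp; linear_combination (1 / 2 : ℝ) * hu'
  · show quadRoot k l 1 = ((![u + f, u] : Fin 2 → ℤ) 1 : ℝ)
    rw [h1]; simp; linear_combination (1 / 2 : ℝ) * hu'

/-- **`det R = −f` for `Δ = f²`** (`R` is unimodular exactly for `Δ = 1`). [cite: Runge1999EndomorphismRingsAbelianSurfaces, §4 p. 290] -/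
theorem det_rungeMatrix_of_quadDisc_eq_sq {f : ℤ} (hf : 0 ≤ f) (h : quadDisc k l = f ^ 2) :
    (rungeMatrix k l).det = -(f : ℝ) := by
  rw [det_rungeMatrix, h]; push_cast; rw [Real.sqrt_sq (by exact_mod_cast hf)]

end Square

/-! ## §2 `Δ = 1`: `O = ℤ[ω]/(ω² = ω) ≅ ℤ × ℤ`, `R = (1 1; 1 0) ∈ GL₂(ℤ)`, and `π(τ) = P_R · diag(τ₁, τ₂)` -/

section One

/-- **The diagonal point `diag(τ₁, τ₂) ∈ 𝔥₂`** — the period matrix of the product `E_{τ₁} × E_{τ₂}` with its product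
principal polarisation (rows A4-62/A4-63 work on `{Z : z₁₂ = 0}`). [cite: BirkenhakeWilhelm2003, §4 Prop. 4.8 (`δ = 1`) (p. 1830)] [cite: Lange2023AbelianVarietiesComplex, §3.1.1] -/
def diagPoint (τ : Fin 2 → ℍ) : siegelUpperHalfSpace 2 :=
  ⟨Matrix.diagonal fun i ↦ (τ i : ℂ),
    ⟨Matrix.diagonal_transpose _, by
      rw [Matrix.diagonal_map Complex.zero_im]
      exact Matrix.PosDef.diagonal fun i ↦ (τ i).im_pos⟩⟩

/-- The matrix of `diagPoint τ`. [cite: Lange2023AbelianVarietiesComplex, §3.1.1] -/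
@[simp] theorem coe_diagPoint (τ : Fin 2 → ℍ) :
    ((diagPoint τ : siegelUpperHalfSpace 2) : Matrix (Fin 2) (Fin 2) ℂ) = Matrix.diagonal fun i ↦ (τ i : ℂ) := rfl

/-- **The diagonal points are exactly `{Z ∈ 𝔥₂ : z₁₂ = 0}`.** [cite: BirkenhakeWilhelm2003, §4 Prop. 4.8 (p. 1830)] -/
theorem range_diagPoint :
    Set.range diagPoint = {Z : siegelUpperHalfSpace 2 | (Z : Matrix (Fin 2) (Fin 2) ℂ) 0 1 = 0} := by
  ext Z
  constructor
  · rintro ⟨τ, rfl⟩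
    simp
  · intro h
    have h10 : (Z : Matrix (Fin 2) (Fin 2) ℂ) 1 0 = 0 := by
      rw [apply_comm_of_mem Z.2 1 0]; exact h
    obtain ⟨h₀, h₁, -⟩ := im_pos_of_mem Z.2
    refine ⟨![⟨(Z : Matrix (Fin 2) (Fin 2) ℂ) 0 0, h₀⟩, ⟨(Z : Matrix (Fin 2) (Fin 2) ℂ) 1 1, h₁⟩], Subtype.ext ?_⟩
    ext i j
    fin_cases i <;> fin_cases j
    · simp
    · simpa using h.symm
    · simpa using h10.symm
    · simp

/-- **Every product lies on `H_1(𝔥₂)`**: `diag(τ₁, τ₂) ∈ H_1(𝔥₂)` (row A4-62 `mem_humbertLocusOfInvariant_one_of_apply_eq_zero`).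
[cite: BirkenhakeWilhelm2003, §4 Prop. 4.8 (p. 1830)] -/
theorem diagPoint_mem_humbertLocusOfInvariant_one (τ : Fin 2 → ℍ) : diagPoint τ ∈ humbertLocusOfInvariant 1 :=
  mem_humbertLocusOfInvariant_one_of_apply_eq_zero _ (by simp)

/-- `Δ(0, 1) = 1`: the split order `ℤ[ω]`, `ω² = ω`. [cite: Runge1999EndomorphismRingsAbelianSurfaces, §4 p. 290] -/
theorem quadDisc_zero_one : quadDisc 0 1 = 1 := by simp [quadDisc]

/-- `0 < Δ(0, 1)`. [cite: Runge1999EndomorphismRingsAbelianSurfaces, §4 p. 290] -/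
theorem quadDisc_zero_one_pos : 0 < quadDisc 0 1 := by rw [quadDisc_zero_one]; exact one_pos

/-- **For `ω² = ω`: `σ₁(ω) = 1`, `σ₂(ω) = 0`** (the two idempotents of `ℚ × ℚ`). [cite: Runge1999EndomorphismRingsAbelianSurfaces, §4 p. 290] -/
theorem quadRoot_zero_one' : quadRoot 0 1 0 = 1 ∧ quadRoot 0 1 1 = 0 := by
  obtain ⟨h0, h1⟩ := quadRoot_of_quadDisc_eq_sq (k := 0) (l := 1) (f := 1) zero_le_one (by simp [quadDisc])
  exact ⟨by rw [h0]; norm_num, by rw [h1]; norm_num⟩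

/-- **`R = (1 1; 1 0)` for `Δ = 1`** — an INTEGRAL UNIMODULAR matrix. [cite: Runge1999EndomorphismRingsAbelianSurfaces, §4 p. 290] -/
theorem rungeMatrix_zero_one : rungeMatrix 0 1 = (!![(1 : ℤ), 1; 1, 0]).map (Int.cast : ℤ → ℝ) := by
  obtain ⟨h0, h1⟩ := quadRoot_zero_one'
  ext i j
  fin_cases i <;> fin_cases j <;> simp [rungeMatrix, h0, h1]

/-- `(1 1; 1 0)(0 1; 1 −1) = 1`. [folklore] -/
private theorem splitMatrix_mul_inv : !![(0 : ℤ), 1; 1, -1] * !![(1 : ℤ), 1; 1, 0] = 1 := by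
  ext i j; fin_cases i <;> fin_cases j <;> simp [Matrix.mul_apply, Fin.sum_univ_two]

/-- **The `Sp₄(ℤ)`-element `P_R = diag(ᵗR, R⁻¹)` for `R = (1 1; 1 0)`.** [cite: Runge1999EndomorphismRingsAbelianSurfaces, §4 pp. 290–291] -/
def splitSp : Matrix.symplecticGroup (Fin 2) ℝ :=
  blockDiagSp !![(1 : ℤ), 1; 1, 0] !![(0 : ℤ), 1; 1, -1] splitMatrix_mul_inv

/-- **`Δ = 1`: RUNGE'S MODEL IS THE `Sp₄(ℤ)`-TRANSLATE OF THE DIAGONAL — `π_{(0,1)}(τ) = P_R · diag(τ₁, τ₂)`** with the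
INTEGRAL symplectic `P_R = diag(ᵗR, R⁻¹)`, `R = (1 1; 1 0)`: for the split algebra `F = ℚ × ℚ` the abelian surface
`A_{π[R](τ)}` IS the product `E_{τ₁} × E_{τ₂}` as a principally polarised abelian surface (`π(τ) = ᵗR diag(τ) R` with `R`
unimodular). [cite: Runge1999EndomorphismRingsAbelianSurfaces, §4 pp. 290–291] [cite: BirkenhakeWilhelm2003, §4 Prop. 4.8 (p. 1830)] -/
theorem modularEmbedding_zero_one_eq_smul_diagPoint (τ : Fin 2 → ℍ) :
    modularEmbedding 0 1 quadDisc_zero_one_pos τ = splitSp • diagPoint τ := by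
  apply Subtype.ext
  rw [splitSp, coe_blockDiagSp_smul, coe_modularEmbedding, coe_diagPoint, modularEmbeddingMatrix, rungeMatrix_zero_one]
  have e : ((!![(1 : ℤ), 1; 1, 0]).map (Int.cast : ℤ → ℝ)).map ((↑) : ℝ → ℂ) = (!![(1 : ℤ), 1; 1, 0]).map (Int.cast : ℤ → ℂ) := by
    ext i j; simp
  rw [e]

/-- **`H_{(0,1,−1,0,0)} = P_R · {Z : z₁₂ = 0}`: the Humbert locus of the normal form of discriminant `1` (the relation
`z₂ = z₃`) is the `Sp₄(ℤ)`-translate of the diagonal locus of products** — consistent with row A4-62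
(`H_1(𝔥₂) ∋` every diagonal `Z`) and B–W Prop. 4.8 (`H_1` = the products `E₁ × E₂`).
[cite: BirkenhakeWilhelm2003, §4 Prop. 4.8 (p. 1830)] [cite: Runge1999EndomorphismRingsAbelianSurfaces, §4 pp. 290–291] -/
theorem humbertLocus_humbertNormalForm_zero_one :
    humbertLocus (fun i ↦ (humbertNormalForm 0 1 i : ℂ)) =
      (fun Z ↦ splitSp • Z) '' {Z : siegelUpperHalfSpace 2 | (Z : Matrix (Fin 2) (Fin 2) ℂ) 0 1 = 0} := by
  rw [← range_modularEmbedding quadDisc_zero_one_pos, ← range_diagPoint, ← Set.range_comp]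
  congr 1
  funext τ
  exact modularEmbedding_zero_one_eq_smul_diagPoint τ

end One

end SiegelModuli

end Literature.AlgebraicGeometry.ModuliOfAbelianVarieties
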